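import Summits.QuantumFields.QCD.Theorems.HeatSlicedQuarksRobustYangMillsHandoverStubDetDiracMatrixTwoSourcesSmit
import Summits.QuantumFields.QCD.Theorems.HeatSlicedQuarksRobustYangMillsHandoverStubFermiIntegralBilinearCyclicSupertrace
import HarnessLib

/-!
# Stub `stub_two_bilinears_cyclic_supertrace` of line `pin-the-infimum`
(crux `RobustYangMillsHandover`, 8892)

E2 (fermionic insertions in Lüscher's transfer form), layer E2-d(2): **two equal-time bilinear
insertions at distinct times — the Haar-weighted gauge integral of the two-bilinear Berezin
integral as a cyclic kernel supertrace with TWO link-free Fock insertions, and the torus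
expectation of the product of the two bilinears as a RATIO of cyclic supertrace integrals.**

For an `SU(3)` gauge field on the four-torus `(ℤ/L)⁴`, `N_f` flavours of `r = 1` Wilson quarks with
masses `mq f > −1`, slices `t₁ ≠ t₂` and source blocks `Jh₁`, `Jh₂` on the quark variables of these
slices (torus-level equal-time sources `Jt t_k Jh_k`), write `cyc Q` for the cyclic kernel
supertrace integral with slot insertions `Q i (Us i)` in front of the slice-`i` factor
`T̂_F(Us i) Γ(G_{gs i})`, and `ε = (−1)^{n(n−1)/2 + n}` (`n` = number of quark variables).

(1) `∫ e^{−β S_W(U)} ∫dψ̄dψ (ψ̄ Jt₂ ψ)(ψ̄ Jt₁ ψ) e^{−ψ̄D(U)ψ} ∏_e dU_e = ε · cyc Q₁₂`, with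
`Q₁₂ i V = 𝒦¹_i(V) 𝒦²_i(V)`, `𝒦ᵏ_i(V) = ins V Jh_k` if `i = t_k` and `1` otherwise: the per-background
two-bilinear Berezin identity (`stub_det_diracMatrix_two_sources_smit`, conjunct (b)) transported
along the measure-preserving, measurably-embedding time-assembling map exactly as the one-insertion
template `stub_fermiIntegral_bilinear_cyclic_supertrace` (b) (`MeasurePreserving.integral_comp`,
`CyclicSupertrace.exp_wilsonAction_timeAssemble`, slicing dictionary); slot by slot the insertion
evaluated at `Us t_k` is the insertion evaluated at `Us i` on the slice `i = t_k`
(`StubTwoBilinearsCyclicSupertrace.slot_eq`).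

(2) `qcdTorusExpect β L mq ((ψ̄ Jt₂ ψ)(ψ̄ Jt₁ ψ)) = cyc Q₁₂ / cyc 1`: numerator and denominator of the
torus functional are Wilson-measure integrals, i.e. Haar integrals divided by `Z_W`
(`TorusDenominator.integral_wilsonMeasure_eq_div`); the numerator is (1), the denominator is
`ε · cyc 1` (`fermiIntegral_fermiBoltzmann` and the `N_f`-flavour capstone C
`qcd_boltzmann_integral_eq_cyclic_supertrace_flavour`); `Z_W ≠ 0` and `ε ≠ 0` cancel
(`div_div_div_cancel_right₀`, `mul_div_mul_left`) — the meson two-point function at kernel level,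
the input of the spectral double-sum step.

Pure theorem file (no definitions).  References: M. Lüscher, Comm. Math. Phys. 54 (1977) 283–292;
K. Osterwalder, E. Seiler, Ann. Phys. 110 (1978) 440, §2; I. Montvay, G. Münster, *Quantum Fields
on a Lattice* (CUP 1994), §4.1 (4.14)–(4.17), §5.1; J. Smit, *Introduction to Quantum Fields on a
Lattice* (CUP 2002/2023), §4.6, §6.5 (6.91).
-/

noncomputable section

namespace Summit.QuantumFields.QCD.Cruxes.RobustYangMillsHandover.PinTheInfimum

open Literature.MathematicalPhysics.QuantumLattice Literature.MathematicalPhysics.QuantumFieldTheory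
open Literature.Probability.LatticeModels (TorusSite)
open MeasureTheory
open Summit.QuantumFields.QCD.Cruxes.StableActionBridge.Sketch

namespace StubTwoBilinearsCyclicSupertrace

/-- **Slot matching.**  In slot `c` of the time-ordered product, the two insertions evaluated at the
configurations of their own slices `U t₁`, `U t₂` agree with the insertions evaluated at the
configuration `U c` of the running slice (the `if` only fires on `c = t_k`), and
`a · (b · x) = (a · b) · x`. [folklore] -/
theorem slot_eq {ι G J M : Type*} [DecidableEq ι] [Monoid M] (ins : G → J → M) (U : ι → G)
    (c t₁ t₂ : ι) (J₁ J₂ : J) (X : M) :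
    (if c = t₁ then ins (U t₁) J₁ else 1) * ((if c = t₂ then ins (U t₂) J₂ else 1) * X) =
      (if c = t₁ then ins (U c) J₁ else 1) * (if c = t₂ then ins (U c) J₂ else 1) * X := by
  rw [← mul_assoc]
  congr 2
  · split_ifs with h
    · rw [h]
    · rfl
  · split_ifs with h
    · rw [h]
    · rfl

end StubTwoBilinearsCyclicSupertrace

-- The registered signature feeds `qcdTorusExpect` the Grassmann-valued observable `fun U => (ψ̄ Jt₂ ψ)(ψ̄ Jt₁ ψ)`,
-- which does not depend on the gauge field `U`, so `linter.unusedVariables` reports that binder for every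
-- proof; the linter is switched off for this one declaration only.
set_option linter.unusedVariables false in
/-- **E2-d(2): two equal-time bilinear insertions at distinct times — Haar-weighted gauge integral
as a cyclic kernel supertrace with two link-free Fock insertions, and the torus expectation of the
product of the two bilinears as a ratio of cyclic supertrace integrals.**  For `SU(3)` gauge fields
on `(ℤ/L)⁴`, `N_f` flavours of `r = 1` Wilson quarks with masses `mq f > −1`, slices `t₁ ≠ t₂`,
source blocks `Jh₁`, `Jh₂` (torus-level equal-time sources `Jt t_k Jh_k`), `cyc Q` the cyclic kernel
supertrace integral with slot insertions `Q i (Us i)` and `ε = (−1)^{n(n−1)/2 + n}`: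
(1) `∫ e^{−β S_W} ∫dψ̄dψ (ψ̄ Jt₂ ψ)(ψ̄ Jt₁ ψ) e^{−ψ̄Dψ} dU = ε · cyc (𝒦¹ 𝒦²)` with the link-free
insertions `𝒦ᵏ_i(V) = ins V Jh_k` on the slice `i = t_k` (`1` otherwise) — the per-background
two-bilinear Berezin identity transported along the measure-preserving time-assembling map;
(2) `⟨(ψ̄ Jt₂ ψ)(ψ̄ Jt₁ ψ)⟩_{β,L,mq} = cyc (𝒦¹ 𝒦²) / cyc 1` — the orientation sign `ε` and the
pure-gauge partition function `Z_W` cancel between numerator and denominator: Lüscher's transfer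
form of the meson two-point function at kernel level (registered stub signature verbatim, header on
one line). [cite: Luscher1977, pp. 283–292] [cite: OsterwalderSeiler1978, §2] -/
theorem stub_two_bilinears_cyclic_supertrace : ∀ (Nf L : ℕ) [NeZero L] (β : ℝ) (mq : Fin Nf → ℝ), (∀ f, -1 < mq f) → ∀ (t₁ t₂ : ZMod L), t₁ ≠ t₂ → ∀ (Jh₁ Jh₂ : Matrix (SliceQuarkVar Nf L) (SliceQuarkVar Nf L) ℂ), let Jt : ZMod L → Matrix (SliceQuarkVar Nf L) (SliceQuarkVar Nf L) ℂ → Matrix (FermiIdx Nf L) (FermiIdx Nf L) ℂ := fun t J => Matrix.reindex quarkEquiv quarkEquiv (Matrix.of fun v w : QuarkVar Nf L => if v.2.1 0 = t ∧ w.2.1 0 = t then J (v.1, (Fin.tail v.2.1, v.2.2)) (w.1, (Fin.tail w.2.1, w.2.2)) else 0); let ins : GaugeConfig 3 L (Matrix.specialUnitaryGroup (Fin 3) ℂ) → Matrix (SliceQuarkVar Nf L) (SliceQuarkVar Nf L) ℂ → Matrix (Finset (SliceFermiIdx Nf L)) (Finset (SliceFermiIdx Nf L)) ℂ := fun V J =>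 dGamma (Matrix.reindex sliceQuarkEquiv sliceQuarkEquiv (sliceKron (Nf := Nf) (S := L) 1 (gammaFive * euclideanGamma 0) * ((-sliceKron (Nf := Nf) (S := L) 1 timeProjPlus + sliceKron (Nf := Nf) (S := L) 1 timeProjPlus * (sliceKron (Nf := Nf) (S := L) 1 (euclideanGamma 0) * sliceDiracKinetic V) * sliceKron ((sliceMassHop V mq)⁻¹) 1 * sliceKron (Nf := Nf) (S := L) 1 timeProjMinus + sliceKron ((sliceMassHop V mq)⁻¹) 1 * sliceKron (Nf := Nf) (S := L) 1 timeProjMinus) * J * (sliceKron (Nf := Nf) (S := L) 1 timeProjMinus + sliceKron (Nf := Nf) (S := L) 1 timeProjPlus * (sliceKron (Nf := Nf) (S := L) 1 (euclideanGamma 0 * gammaFive) * (fermionSliceMatrix V mq)⁻¹ * sliceKron (Nf := Nf) (S := L) 1 (gammaFive * euclideanGamma 0)))) * sliceKron (Nf := Nf) (S := L) 1 (euclideanGamma 0 * gammaFive))) - (J * sliceKron ((sliceMassHop V mq)⁻¹) 1 * sliceKron (Nf := Nf) (S := L) 1 timeProjMinus).trace • (1 : Matrix (Finset (SliceFermiIdx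 Nf L)) (Finset (SliceFermiIdx Nf L)) ℂ); let cyc : (ℕ → GaugeConfig 3 L (Matrix.specialUnitaryGroup (Fin 3) ℂ) → Matrix (Finset (SliceFermiIdx Nf L)) (Finset (SliceFermiIdx Nf L)) ℂ) → ℂ := fun Q => ∫ p : (ZMod L → GaugeConfig 3 L (Matrix.specialUnitaryGroup (Fin 3) ℂ)) × (ZMod L → TorusSite 3 L → Matrix.specialUnitaryGroup (Fin 3) ℂ), ((∏ t : ZMod L, gaugeSliceKernel β (p.1 t) (gaugeTransform (p.2 t) (p.1 (t + 1))) : ℝ) : ℂ) * ∑ S : Finset (SliceFermiIdx Nf L), (-1 : ℂ) ^ S.card * (((List.range L).map fun i : ℕ => Q i (p.1 (i : ZMod L)) * (fermionSliceOp (p.1 (i : ZMod L)) mq * fockGaugeAct (Nf := Nf) (p.2 (i : ZMod L)))).prod) S S ∂((Measure.pi fun _ : ZMod L => Measure.pi fun _ : Edge 3 L => haarProbability (Matrix.specialUnitaryGroup (Fin 3) ℂ)).prod (Measure.pi fun _ : ZMod L => Measure.pi fun _ : TorusSite 3 L => haarProbability (Matrix.specialUnitaryGroup (Fin 3) ℂ)));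 ∫ U : GaugeConfig 4 L (Matrix.specialUnitaryGroup (Fin 3) ℂ), (Real.exp (-(β * wilsonAction (fundamentalRep (Fin 3)) U)) : ℂ) * fermiIntegral (quadratic ℂ (Jt t₂ Jh₂) * quadratic ℂ (Jt t₁ Jh₁) * fermiBoltzmann U mq) ∂(Measure.pi fun _ : Edge 4 L => haarProbability (Matrix.specialUnitaryGroup (Fin 3) ℂ)) = (-1 : ℂ) ^ (Fintype.card (FermiIdx Nf L) * (Fintype.card (FermiIdx Nf L) - 1) / 2 + Fintype.card (FermiIdx Nf L)) * cyc (fun i V => (if (i : ZMod L) = t₁ then ins V Jh₁ else 1) * (if (i : ZMod L) = t₂ then ins V Jh₂ else 1)) ∧ qcdTorusExpect β L mq (fun U => quadratic ℂ (Jt t₂ Jh₂) * quadratic ℂ (Jt t₁ Jh₁)) = cyc (fun i V => (if (i : ZMod L) = t₁ then ins V Jh₁ else 1) * (if (i : ZMod L) = t₂ then ins V Jh₂ else 1)) / cyc (fun _ _ => 1) := by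
  intro Nf L _ β mq hm t₁ t₂ h12 Jh₁ Jh₂ Jt ins cyc
  /- the per-background two-source theorem, its `let`s merged with ours -/
  have hts := fun U : GaugeConfig 4 L (Matrix.specialUnitaryGroup (Fin 3) ℂ) =>
    stub_det_diracMatrix_two_sources_smit Nf L U mq hm t₁ t₂ h12 Jh₁ Jh₂
  extract_lets at hts
  refine StubFermiIntegralBilinearCyclicSupertrace.and_of_imp ?_ fun h1 => ?_
  · /- (1): transport along the time-assembling map (measure preserving, measurable embedding), then
      the pointwise identity: `e^{−β S_W(asm p)} = ∏_t K_β` and the two-bilinear Berezin identity at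
      `U = asm p` read through the slicing dictionary, slot by slot. -/
    dsimp only [cyc]
    obtain ⟨hasm, -⟩ :=
      Summit.QuantumFields.YangMills.Theorems.WeakCouplingHypercubicLimit.TraceNormColdPressure.stub_timeSlicing
        L (Matrix.specialUnitaryGroup (Fin 3) ℂ) (fundamentalRep (Fin 3))
    rw [← hasm.integral_comp
        (StubFermiIntegralBilinearCyclicSupertrace.measurableEmbedding_timeAssemble L),
      ← GluonicExpectation.integral_weight_mul_const_mul]
    refine integral_congr_ae (ae_of_all _ fun p => ?_)
    dsimp only
    rw [CyclicSupertrace.exp_wilsonAction_timeAssemble L β p.1 p.2, (hts _).2]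
    simp only [Fin.cons_succ, Fin.cons_zero, Fin.tail_cons, Prod.mk.eta,
      StubTwoBilinearsCyclicSupertrace.slot_eq ins p.1]
  · /- (2): Wilson-measure integrals as Haar quotients; the numerator is (1), the denominator is
      `ε · cyc 1` (Berezin Gaussian formula and capstone C); cancel `Z_W` and `ε`. -/
    unfold qcdTorusExpect
    simp only [fermiIntegral_fermiBoltzmann]
    rw [TorusDenominator.integral_wilsonMeasure_eq_div (continuous_fundamentalRep (Fin 3)) β,
      TorusDenominator.integral_wilsonMeasure_eq_div (continuous_fundamentalRep (Fin 3)) β,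
      div_div_div_cancel_right₀ (GluonicExpectation.ofReal_integral_exp_wilsonAction_ne_zero L β),
      GluonicExpectation.integral_weight_mul_const_mul, h1,
      mul_div_mul_left _ _ (fermiOrientationSign_ne_zero _),
      qcd_boltzmann_integral_eq_cyclic_supertrace_flavour Nf L β mq hm]
    simp only [cyc, one_mul]

end Summit.QuantumFields.QCD.Cruxes.RobustYangMillsHandover.PinTheInfimum

end
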